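import Literature.MathematicalPhysics.QuantumLattice.XYOrder
import Literature.Probability.LatticeModels.TorusFourier
import HarnessLib

/-!
# Kennedy–Lieb–Shastry, XY model: the finite-volume architecture of the proof

Trunk T-QLATTICE; sibling of `XYOrder.lean` (named fact `kennedy_lieb_shastry_xy_ground`, item
`provefact-Literature.Hubbard.kennedy_lieb_shastry_xy_ground`). This file decomposes the proof of
Kennedy–Lieb–Shastry, PRL 61 (1988) 2582, eqs. (1)–(8), into its printed intermediate results,
each vendored as a named fact about the *finite* even tori `(ℤ/2kℤ)^d` and the tracial ground-state
functional of `xyTorus d L n` (the objects of `XYOrder.lean`), so that they can be discharged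
bottom-up. The deep input is the `T = 0` infrared bound (A); (B)–(D), (S) are finite-dimensional
variational / symmetry / Fourier statements; (R), (M), (E) concern an explicit lattice integral.

* (A) `kls_xy_infraredBound_ground` — KLS eq. (4): for `p ≠ 0`,
  `0 ≤ ĝ¹_p ≤ ½ [Σᵢ (e₁ - e₃ cos pᵢ) / Σᵢ (1 - cos pᵢ)]^{1/2}` (reflection positivity ⇒ Gaussian
  domination in the ground state, KLS J. Stat. Phys. 53 (1988) eqs. (12)–(14), (18); or the
  `T → 0` limit of Dyson–Lieb–Simon's bound, Neves–Perez 1986).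
* (B) `kubo_xy_bondCorr_abs_le` — `|e₃| ≤ e₁` (Kubo; KLS after eq. (4)).
* (C) `xy_structureFactor_sumRule` — the sum rule KLS eq. (3)/(6) in finite volume (Parseval).
* (D) `kls_xy_bondCorr_lower` — `e₁ ≥ S²/2` (variational, all spins aligned along the 1-axis).
* (S) `xy_groundCorr_two_eq_one` — `⟨S²_x S²_y⟩ = ⟨S¹_x S¹_y⟩` (the `U(1)` symmetry "by symmetry").
* (T) `xyGroundCorr_abs_le` — `|G^α(x,y)| ≤ S²` (states have norm one; boundedness of the LRO
  sequence).
* (R) `klsRiemannSum_tendsto` — the Riemann sums of the KLS integrand over the punctured dual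
  torus converge to `I(ν)` ("passing from sums to integrals", KLS before eq. (2)).
* (M) `klsIntegral_le_two` — `I(ν) ≤ I(2)` for `ν ≥ 2` (KLS, convexity of `x[(1+x)/(1-x)]^{1/2}`).
* (E) `klsIntegral_two_le` — the numerical input `I(2) ≤ 0.7` (KLS: `I(2) = 0.65`).

Assembly (KLS eqs. (5)–(8)), PROVED here as `kennedy_lieb_shastry_xy_ground_of_facts`
(so `kennedy_lieb_shastry_xy_ground_holds` will follow once (A)–(E) are discharged):
(C) at `α = 1` split at `p = 0`, (A)+(B) give `e₁ ≤ |Λ|⁻¹ ĝ¹₀ + ½ e₁^{1/2} R_L`, (D) and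
monotonicity of `x ↦ x - ½ R √x` on `√x ≥ R/4` give
`|Λ|⁻¹ ĝ¹₀ ≥ S²/2 - ½ (S/√2) R_L`, (R)+(M)+(E) give `limsup R_L ≤ 0.7 < 2 · S/√2` for all
`S ≥ 1/2`, and `|Λ|⁻² Σ_{x,y} ⟨S¹_x S¹_y + S²_x S²_y⟩ = 2 |Λ|⁻¹ ĝ¹₀` by (S).

## Sources

* T. Kennedy, E. H. Lieb, B. S. Shastry, *The XY model has long-range order for all spins and all
  dimensions greater than one*, Phys. Rev. Lett. 61 (1988) 2582–2584 (`KLS1988PRL`), eqs. (1)–(8)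
  (read in: E. H. Lieb, *Statistical Mechanics (Selecta)*, Springer 2004, paper IV.8, pp. 327–329).
* T. Kennedy, E. H. Lieb, B. S. Shastry, *Existence of Néel order in some spin-1/2 Heisenberg
  antiferromagnets*, J. Stat. Phys. 53 (1988) 1019–1030 (`KLS1988JSP`), eqs. (1), (3), (12)–(14),
  (18)–(25) (the direct ground-state proof of the infrared bound).
* K. Kubo, *Existence of long-range order in the XY model*, Phys. Rev. Lett. 61 (1988) 110
  (`Kubo1988PRL`).
* F. J. Dyson, E. H. Lieb, B. Simon, J. Stat. Phys. 18 (1978) 335 (`DysonLiebSimon1978`).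
* E. J. Neves, J. F. Perez, Phys. Lett. A 114 (1986) 331 (`NevesPerez1986`).

## Design choices

* Momenta of the dual torus are indexed by `k : TorusSite d L` itself, `pᵢ = 2π kᵢ.val / L` is the
  tree's `latticeMomentum L k i` and `E_p = Σᵢ (1 - cos pᵢ)` its `dispersion (latticeMomentum L k)`
  (`Literature/Probability/LatticeModels/TorusFourier.lean`); the phase `p · x` is computed on
  canonical representatives (`ZMod.val`), which is harmless under `cos` (multiples of `2π`).
* KLS's `e₁ = ⟨S¹_0 S¹_{δᵢ}⟩`, `e₃ = ⟨S³_0 S³_{δᵢ}⟩` ("clearly independent of `i`", and of the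
  base point by translation invariance) are vendored as the site- and direction-*averaged*
  nearest-neighbour correlations `xyBondCorr α L n`; on the cubic torus the tracial ground-state
  functional is invariant under all lattice symmetries, so these are the same numbers, and the
  averaged form is what the sum rule (C) produces literally.
* All correlation functions carry the junk value `0` at `L = 0` (as in `XYOrder.lean`); the facts
  quantify over genuine tori. (A) is stated on even sides `L = 2k ≥ 4` (reflection positivity
  needs even side; `L = 2` is excluded because `torusGraph d 2` is the simple hypercube graph, not
  the doubled-bond torus of the texts — immaterial for a `liminf`).
* (A) is vendored in the squared form `ĝ² · Σᵢ(1 - cos pᵢ) ≤ ¼ Σᵢ (e₁ - e₃ cos pᵢ)` together with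
  `0 ≤ ĝ`, which is the printed inequality (4) freed of `Real.sqrt` (the radicand is `≥ 0` by (B)).
* (E): the source reports the numerical value `I(2) = 0.65` (our own punctured Riemann sums:
  `R_{2048} = 0.6459…`, increasing in `L`, extrapolating to `I(2) ≈ 0.647`). We vendor the *weaker*
  bound `I(2) ≤ 7/10`, which is all the proof consumes (`½ I(2) < S/√2` for `S = ½` needs
  `I(2) < 0.7071…`) and is the easier target for a later interval-arithmetic discharge.
-/

noncomputable section

open Filter Topology Matrix Finset MeasureTheory
open Literature.MathematicalPhysics.QuantumLattice Literature.Probability.LatticeModels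

namespace Literature.MathematicalPhysics.QuantumLattice

variable {d : ℕ}

/-! ### Dual torus: phases and the cosine sum (momenta and dispersion are `latticeMomentum`,
`dispersion` of `TorusFourier.lean`) -/

/-- Unfolding a component of `latticeMomentum`. [folklore] -/
theorem latticeMomentum_apply (L : ℕ) (k : TorusSite d L) (i : Fin d) :
    latticeMomentum L k i = 2 * Real.pi * ((k i).val : ℝ) / L := rfl

/-- The phase `p · x = (2π/L) Σᵢ kᵢ xᵢ` (on canonical representatives; well defined modulo `2π`,
so `cos (p · x)` is a function on the torus). [Kennedy–Lieb–Shastry 1988, def. of `Ŝ_p`]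
[cite: KLS1988PRL, before eq. (2)] -/
def torusPhase (L : ℕ) (k x : TorusSite d L) : ℝ :=
  2 * Real.pi * (∑ i, ((k i).val : ℝ) * ((x i).val : ℝ)) / (L : ℝ)

/-- `C_p = Σᵢ cos pᵢ`. [Kennedy–Lieb–Shastry 1988, eqs. (5)–(6)] [cite: KLS1988PRL, eq. (6)] -/
def torusCosSum (L : ℕ) (k : TorusSite d L) : ℝ :=
  ∑ i, Real.cos (latticeMomentum L k i)

/-! ### Ground-state correlations of the XY torus, their Fourier transform, bond correlations -/

/-- The ground-state `α–α` correlation `G^α_L(x,y) = Re ω_GS(S^α_x S^α_y)` of the ferromagnetic XY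
model `xyTorus d L n` (tracial ground-state functional; junk `0` at `L = 0`).
[Kennedy–Lieb–Shastry 1988, two-point function] [cite: KLS1988PRL, before eq. (2)] -/
def xyGroundCorr (α : Fin 3) (L n : ℕ) (x y : TorusSite d L) : ℝ :=
  if hL : L = 0 then 0
  else
    haveI : NeZero L := ⟨hL⟩
    ((xyTorus d L n).groundStateFunctional (siteSpin n x α * siteSpin n y α)).re

/-- The ground-state structure factor
`ĝ^α_p = ⟨Ŝ^α_p Ŝ^α_{-p}⟩ = |Λ|⁻¹ Σ_{x,y} cos(p·(x-y)) G^α(x,y)`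
(`Ŝ_p = |Λ|^{-1/2} Σ_x S_x e^{ip·x}`; the sine part cancels by `x ↔ y`), momenta indexed by the dual
torus point `k`, `p = 2πk/L`; junk `0` at `L = 0`. [Kennedy–Lieb–Shastry 1988, def. of `g^α_p`]
[cite: KLS1988PRL, before eq. (2)] -/
def xyStructureFactor (α : Fin 3) (L n : ℕ) (k : TorusSite d L) : ℝ :=
  if hL : L = 0 then 0
  else
    haveI : NeZero L := ⟨hL⟩
    (∑ x : TorusSite d L, ∑ y : TorusSite d L,
        Real.cos (torusPhase L k (x - y)) * xyGroundCorr α L n x y) / (L : ℝ) ^ d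

/-- The nearest-neighbour ground-state correlation in spin direction `α`, averaged over sites and
lattice directions: `e_α = (d L^d)⁻¹ Σ_x Σᵢ G^α_L(x, x + eᵢ)`; KLS's `e₁ = ⟨S¹_0 S¹_{δᵢ}⟩`
(`α = 0`) and `e₃ = ⟨S³_0 S³_{δᵢ}⟩` (`α = 2`), which do not depend on `i` or the base point.
Junk `0` at `L = 0` or `d = 0`. [Kennedy–Lieb–Shastry 1988, eq. (3) and after eq. (4)]
[cite: KLS1988PRL, eq. (3)] -/
def xyBondCorr (α : Fin 3) (L n : ℕ) : ℝ :=
  if hL : L = 0 then 0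
  else
    haveI : NeZero L := ⟨hL⟩
    (∑ x : TorusSite d L, ∑ i : Fin d, xyGroundCorr α L n x (x + Pi.single i 1)) /
      ((d : ℝ) * (L : ℝ) ^ d)

/-! ### The KLS lattice integral `I(ν)` and its Riemann sums -/

/-- The KLS integrand `F_ν(p) = [Σᵢ (1 + cos pᵢ) / Σᵢ (1 - cos pᵢ)]^{1/2} {ν⁻¹ Σᵢ cos pᵢ}₊`
(`{a}₊ = max a 0`); junk value at `p ≡ 0` through `x / 0 = 0`.
[Kennedy–Lieb–Shastry 1988, eq. (8)] [cite: KLS1988PRL, eq. (8)] -/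
def klsIntegrand (ν : ℕ) (p : Fin ν → ℝ) : ℝ :=
  Real.sqrt ((∑ i, (1 + Real.cos (p i))) / (∑ i, (1 - Real.cos (p i)))) *
    max ((∑ i, Real.cos (p i)) / (ν : ℝ)) 0

/-- `I(ν) = (2π)^{-ν} ∫_{[-π,π]^ν} F_ν(p) dp` (Lebesgue integral of the nonnegative, integrable for
`ν ≥ 2`, KLS integrand over the Brillouin zone). [Kennedy–Lieb–Shastry 1988, eq. (8)]
[cite: KLS1988PRL, eq. (8)] -/
def klsIntegral (ν : ℕ) : ℝ :=
  (∫ p in Set.pi Set.univ (fun _ : Fin ν => Set.Icc (-Real.pi) Real.pi), klsIntegrand ν p) /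
    (2 * Real.pi) ^ ν

/-- The Riemann sum `R_L = L^{-ν} Σ_{k ∈ (ℤ/Lℤ)^ν, k ≠ 0} F_ν(2πk/L)` of the KLS integrand over the
punctured dual torus (junk `0` at `L = 0`). [Kennedy–Lieb–Shastry 1988, eqs. (5)–(8) in finite
volume] [cite: KLS1988PRL, eq. (8)] -/
def klsRiemannSum (ν L : ℕ) : ℝ :=
  if hL : L = 0 then 0
  else
    haveI : NeZero L := ⟨hL⟩
    (∑ k ∈ (univ : Finset (TorusSite ν L)).erase 0, klsIntegrand ν (latticeMomentum L k)) /
      (L : ℝ) ^ ν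

/-! ### The named intermediate results -/

/-- **(A) Infrared bound in the ground state** (Kennedy–Lieb–Shastry 1988, eq. (4)). For every
`d ≥ 2`, spin `n/2 ≥ 1/2`, even side `L = 2k ≥ 4` and momentum `p ≠ 0` of the dual torus,
`0 ≤ ĝ¹_p ≤ ½ [Σᵢ (e₁ - e₃ cos pᵢ) / Σᵢ (1 - cos pᵢ)]^{1/2}`, stated in the equivalent squared form
`(ĝ¹_p)² Σᵢ (1 - cos pᵢ) ≤ ¼ Σᵢ (e₁ - e₃ cos pᵢ)`. "This bound is true for every finite `Λ`": it is
the `T → 0` limit of the Dyson–Lieb–Simon Gaussian-domination bound (Neves–Perez), or directly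
KLS J. Stat. Phys. 53 (1988): Cauchy–Schwarz on the spectral weight (12), the double commutator
(13) and the ground-state susceptibility bound `χ_p ≤ ¼ E_p⁻¹` (14) from `E(h) ≥ E(0)` (18).
[Kennedy–Lieb–Shastry 1988, eq. (4); KLS J. Stat. Phys. 53 (1988) eqs. (1), (12)–(14);
Dyson–Lieb–Simon 1978] [cite: KLS1988PRL, eq. (4)] [cite: KLS1988JSP, eqs. (1), (12)–(14)] -/
def kls_xy_infraredBound_ground : Prop :=
  ∀ (d : ℕ), 2 ≤ d → ∀ (n : ℕ), 1 ≤ n → ∀ (k : ℕ), 2 ≤ k →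
    ∀ q : TorusSite d (2 * k), q ≠ 0 →
      0 ≤ xyStructureFactor 0 (2 * k) n q ∧
        xyStructureFactor 0 (2 * k) n q ^ 2 * dispersion (latticeMomentum (2 * k) q) ≤
          (1 / 4 : ℝ) * ∑ i, (xyBondCorr (d := d) 0 (2 * k) n -
            xyBondCorr (d := d) 2 (2 * k) n * Real.cos (latticeMomentum (2 * k) q i))

/-- **(B) Kubo's inequality** `|e₃| ≤ e₁` on even tori ("for otherwise the energy could be lowered
by interchanging the 1 and 3 spin directions"; the sign of `e₃` is flipped by the `π`-rotation
about the 2-axis on one sublattice of the bipartite even torus).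
[Kennedy–Lieb–Shastry 1988, between eqs. (4) and (5); Kubo, PRL 61 (1988) 110]
[cite: KLS1988PRL, after eq. (4)] [cite: Kubo1988PRL] -/
def kubo_xy_bondCorr_abs_le : Prop :=
  ∀ (d : ℕ), 1 ≤ d → ∀ (n k : ℕ), 1 ≤ k →
    |xyBondCorr (d := d) 2 (2 * k) n| ≤ xyBondCorr (d := d) 0 (2 * k) n

/-- **(C) The sum rule** (finite-volume Parseval form of Kennedy–Lieb–Shastry 1988, eqs. (3), (6)):
`|Λ|⁻¹ Σ_p ĝ^α_p (d⁻¹ Σᵢ cos pᵢ) = e_α`, by orthogonality of characters of `(ℤ/Lℤ)^d`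
(`Σ_p cos(p·z) cos pᵢ = ½|Λ|(δ_{z,eᵢ} + δ_{z,-eᵢ})`) and the symmetry `G^α(x,y) = G^α(y,x)`.
(The instance binder `[NeZero L]` only supplies `Fintype (TorusSite d L)` for the momentum sum;
`ZMod 0 = ℤ` is not finite.)
[Kennedy–Lieb–Shastry 1988, eqs. (3), (6)] [cite: KLS1988PRL, eq. (6)] -/
def xy_structureFactor_sumRule : Prop :=
  ∀ (d : ℕ), 1 ≤ d → ∀ (α : Fin 3) (L : ℕ) [NeZero L] (n : ℕ), 2 ≤ L →
    (∑ q : TorusSite d L, xyStructureFactor α L n q * (torusCosSum L q / d)) / (L : ℝ) ^ d =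
      xyBondCorr (d := d) α L n

/-- **(D) The variational lower bound** `e₁ ≥ ½ S²` (`S = n/2`): the product state with all spins
aligned along the 1-axis has energy `-S²` per bond, and `e₁ = e₂ = -½ E₀ / #bonds` by the `U(1)`
symmetry. Sides `L ≥ 2` (for `L = 1` the "bond" is the on-site square).
[Kennedy–Lieb–Shastry 1988, after eq. (8): "a simple variational argument … shows `e₁ ≥ ½ S²` in
all dimensions"] [cite: KLS1988PRL, after eq. (8)] -/
def kls_xy_bondCorr_lower : Prop :=
  ∀ (d : ℕ), 1 ≤ d → ∀ (L n : ℕ), 2 ≤ L →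
    ((n : ℝ) / 2) ^ 2 / 2 ≤ xyBondCorr (d := d) 0 L n

/-- **(S) `1 ↔ 2` symmetry**: `⟨S²_x S²_y⟩_GS = ⟨S¹_x S¹_y⟩_GS` (the rotation by `π/2` about the
3-axis is a symmetry of `xyTorus` mapping `S¹ ↦ S²`, `S² ↦ -S¹`, and the tracial ground-state
functional is invariant under symmetries of the Hamiltonian). [Kennedy–Lieb–Shastry 1988, "by
symmetry" after eq. (3)] [folklore] -/
def xy_groundCorr_two_eq_one : Prop :=
  ∀ (d L n : ℕ) (x y : TorusSite d L), xyGroundCorr 1 L n x y = xyGroundCorr 0 L n x y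

/-- **(T) A priori bound** `|G^α_L(x,y)| ≤ S²`: a state has norm one, `|ω(A)| ≤ ‖A‖`, and
`‖S^α_x S^α_y‖ ≤ ‖S^α‖² = S²` (`S = n/2`). Needed only to know that the LRO sequence is bounded
(Mathlib's `liminf` on `ℝ` is a conditionally complete `sSup`). [folklore] -/
def xyGroundCorr_abs_le : Prop :=
  ∀ (α : Fin 3) (d L n : ℕ) (x y : TorusSite d L), |xyGroundCorr α L n x y| ≤ ((n : ℝ) / 2) ^ 2

/-- **(R) Sums to integrals**: for `ν ≥ 2` the Riemann sums of the KLS integrand over the punctured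
dual torus converge to `I(ν)` (the integrand is continuous off `p ≡ 0` and `O(|p|⁻¹)` at `0`,
integrable in dimension `≥ 2`). [Kennedy–Lieb–Shastry 1988, before eq. (2): "taking the usual
infinite-volume limit and passing from sums to integrals"; Dyson–Lieb–Simon 1978, §3] [folklore] -/
def klsRiemannSum_tendsto : Prop :=
  ∀ (ν : ℕ), 2 ≤ ν → Tendsto (fun L : ℕ => klsRiemannSum ν L) atTop (𝓝 (klsIntegral ν))

/-- **(M) Monotonicity in the dimension**: `I(ν) ≤ I(2)` for all `ν ≥ 2` (KLS: `F(x) =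
x[(1+x)/(1-x)]^{1/2}` is increasing and convex on `[0,1)`, `{·}₊` is subadditive, and
`ν⁻¹ Σᵢ cos pᵢ` is the average of the pair averages `½(cos pᵢ + cos pⱼ)`).
[Kennedy–Lieb–Shastry 1988, the paragraph after eq. (8)] [cite: KLS1988PRL, after eq. (8)] -/
def klsIntegral_le_two : Prop :=
  ∀ (ν : ℕ), 2 ≤ ν → klsIntegral ν ≤ klsIntegral 2

/-- **(E) The numerical input** `I(2) ≤ 0.7`. The source states the numerical value `I(2) = 0.65`
(and `I(3) = 0.35`); we vendor the weaker inequality actually consumed by the proof (see the module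
docstring). [Kennedy–Lieb–Shastry 1988, after eq. (8)] [cite: KLS1988PRL, after eq. (8)] -/
def klsIntegral_two_le : Prop :=
  klsIntegral 2 ≤ 7 / 10

/-! ### API -/

/-- Junk side. [folklore] -/
@[simp] theorem xyGroundCorr_zero_side (α : Fin 3) (n : ℕ) (x y : TorusSite d 0) :
    xyGroundCorr α 0 n x y = 0 := by
  simp [xyGroundCorr]

/-- Unfolding on a genuine torus. [folklore] -/
theorem xyGroundCorr_of_neZero (α : Fin 3) (L : ℕ) [NeZero L] (n : ℕ) (x y : TorusSite d L) :
    xyGroundCorr α L n x y =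
      ((xyTorus d L n).groundStateFunctional (siteSpin n x α * siteSpin n y α)).re := by
  simp [xyGroundCorr, NeZero.ne L]

/-- Unfolding the structure factor on a genuine torus. [folklore] -/
theorem xyStructureFactor_of_neZero (α : Fin 3) (L : ℕ) [NeZero L] (n : ℕ) (k : TorusSite d L) :
    xyStructureFactor α L n k =
      (∑ x : TorusSite d L, ∑ y : TorusSite d L,
        Real.cos (torusPhase L k (x - y)) * xyGroundCorr α L n x y) / (L : ℝ) ^ d := by
  simp [xyStructureFactor, NeZero.ne L]

/-- Unfolding the bond correlation on a genuine torus. [folklore] -/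
theorem xyBondCorr_of_neZero (α : Fin 3) (L : ℕ) [NeZero L] (n : ℕ) :
    xyBondCorr (d := d) α L n =
      (∑ x : TorusSite d L, ∑ i : Fin d, xyGroundCorr α L n x (x + Pi.single i 1)) /
        ((d : ℝ) * (L : ℝ) ^ d) := by
  simp [xyBondCorr, NeZero.ne L]

/-- Unfolding the Riemann sum on a genuine torus. [folklore] -/
theorem klsRiemannSum_of_neZero (ν L : ℕ) [NeZero L] :
    klsRiemannSum ν L =
      (∑ k ∈ (univ : Finset (TorusSite ν L)).erase 0, klsIntegrand ν (latticeMomentum L k)) /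
        (L : ℝ) ^ ν := by
  simp [klsRiemannSum, NeZero.ne L]

/-- At zero momentum the phase vanishes. [folklore] -/
@[simp] theorem torusPhase_zero_left (L : ℕ) (x : TorusSite d L) : torusPhase L 0 x = 0 := by
  simp [torusPhase]

/-- At zero momentum the structure factor is the volume average of the two-point function,
`ĝ^α_0 = |Λ|⁻¹ Σ_{x,y} G^α(x,y)`. [Kennedy–Lieb–Shastry 1988, LRO ⇔ `δ`-function at `p = 0`]
[cite: KLS1988PRL, before eq. (7)] -/
theorem xyStructureFactor_zero_momentum (α : Fin 3) (L : ℕ) [NeZero L] (n : ℕ) :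
    xyStructureFactor α L n (0 : TorusSite d L) =
      (∑ x : TorusSite d L, ∑ y : TorusSite d L, xyGroundCorr α L n x y) / (L : ℝ) ^ d := by
  simp [xyStructureFactor_of_neZero]

/-- The XY correlation of `XYOrder.lean` is the sum of the `1–1` and `2–2` correlations.
[Kennedy–Lieb–Shastry 1988, the order parameter] [cite: KLS1988PRL, Theorem] -/
theorem groundStateXYCorrTorus_eq_add (L n : ℕ) (x y : TorusSite d L) :
    groundStateXYCorrTorus L n x y = xyGroundCorr 0 L n x y + xyGroundCorr 1 L n x y := by
  rcases Nat.eq_zero_or_pos L with rfl | hL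
  · simp
  · haveI : NeZero L := ⟨hL.ne'⟩
    rw [groundStateXYCorrTorus_of_neZero, xyGroundCorr_of_neZero, xyGroundCorr_of_neZero,
      Fin.sum_univ_two, Complex.add_re]
    rfl

/-- The KLS integrand is nonnegative. [Kennedy–Lieb–Shastry 1988, eq. (8)] [folklore] -/
theorem klsIntegrand_nonneg (ν : ℕ) (p : Fin ν → ℝ) : 0 ≤ klsIntegrand ν p :=
  mul_nonneg (Real.sqrt_nonneg _) (le_max_right _ _)

/-- The Riemann sums are nonnegative. [folklore] -/
theorem klsRiemannSum_nonneg (ν L : ℕ) : 0 ≤ klsRiemannSum ν L := by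
  unfold klsRiemannSum
  split_ifs
  · exact le_rfl
  · exact div_nonneg (sum_nonneg fun _ _ => klsIntegrand_nonneg _ _) (by positivity)

/-! ### Assembly: KLS eqs. (5)–(8) in finite volume, from the named facts

The theorem `kennedy_lieb_shastry_xy_ground_of_facts` below is the printed argument of
Kennedy–Lieb–Shastry (1988) between eq. (4) and the end of the paragraph after eq. (8), carried out
on the finite even tori (so that no infinite-volume two-point function is needed): it reduces
`kennedy_lieb_shastry_xy_ground` to the facts (A), (B), (C), (D), (S), (T), (R), (M), (E). -/

section Assembly

/-- `Σᵢ cos 0 = d`: the cosine sum at zero momentum. [folklore] -/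
theorem torusCosSum_zero (L : ℕ) : torusCosSum L (0 : TorusSite d L) = d := by
  simp [torusCosSum, latticeMomentum_apply]

/-- `Σᵢ (1 + cos pᵢ) = d + C_p`. [folklore] -/
theorem sum_one_add_cos_latticeMomentum (L : ℕ) (q : TorusSite d L) :
    ∑ i, (1 + Real.cos (latticeMomentum L q i)) = d + torusCosSum L q := by
  rw [sum_add_distrib, torusCosSum]
  simp

/-- `Σᵢ (a - b cos pᵢ) = d a - b C_p`. [folklore] -/
theorem sum_const_sub_mul_cos_latticeMomentum (L : ℕ) (q : TorusSite d L) (a b : ℝ) :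
    ∑ i, (a - b * Real.cos (latticeMomentum L q i)) = d * a - b * torusCosSum L q := by
  rw [sum_sub_distrib, torusCosSum, mul_sum]
  simp

/-- The KLS integrand at a dual-torus momentum, in terms of `C_p` and `E_p`. [Kennedy–Lieb–Shastry
1988, eqs. (5), (8)] [folklore] -/
theorem klsIntegrand_latticeMomentum (L : ℕ) (q : TorusSite d L) :
    klsIntegrand d (latticeMomentum L q) =
      Real.sqrt ((d + torusCosSum L q) / dispersion (latticeMomentum L q)) *
        max (torusCosSum L q / d) 0 := by
  rw [klsIntegrand, sum_one_add_cos_latticeMomentum]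
  rfl

/-- `E_p > 0` for every nonzero momentum of a genuine dual torus (some `pᵢ ∈ (0, 2π)`); this is
the `←` half of the tree's named fact `dispersion_latticeMomentum_eq_zero_iff`
(`TorusFourier.lean`). [Kennedy–Lieb–Shastry 1988, eq. (4) is stated for `p ≠ 0`] [folklore] -/
theorem dispersion_latticeMomentum_pos {L : ℕ} [NeZero L] {q : TorusSite d L} (hq : q ≠ 0) :
    0 < dispersion (latticeMomentum L q) := by
  obtain ⟨i, hi⟩ : ∃ i, q i ≠ 0 := by
    by_contra h
    push Not at h
    exact hq (funext h)
  have hL : (0 : ℝ) < L := by exact_mod_cast Nat.pos_of_ne_zero (NeZero.ne L)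
  have hterm : ∀ j, 0 ≤ 1 - Real.cos (latticeMomentum L q j) :=
    fun j => sub_nonneg.2 (Real.cos_le_one _)
  have hlt : 0 < 1 - Real.cos (latticeMomentum L q i) := by
    rw [sub_pos, lt_iff_le_and_ne]
    refine ⟨Real.cos_le_one _, fun h => hi ?_⟩
    have h0 : 0 ≤ latticeMomentum L q i := by rw [latticeMomentum_apply]; positivity
    have hval : ((q i).val : ℝ) < L := by exact_mod_cast ZMod.val_lt (q i)
    have h2 : latticeMomentum L q i < 2 * Real.pi := by
      rw [latticeMomentum_apply, div_lt_iff₀ hL]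
      nlinarith [Real.pi_pos]
    have h1 := (Real.cos_eq_one_iff_of_lt_of_lt (by linarith [Real.pi_pos]) h2).1 h
    rw [latticeMomentum_apply, div_eq_zero_iff] at h1
    rcases h1 with h1 | h1
    · have : ((q i).val : ℝ) = 0 := by
        rcases mul_eq_zero.1 h1 with h3 | h3
        · exact absurd h3 (by positivity)
        · exact h3
      exact (ZMod.val_eq_zero (q i)).1 (by exact_mod_cast this)
    · exact absurd h1 hL.ne'
  calc (0 : ℝ) < 1 - Real.cos (latticeMomentum L q i) := hlt
    _ = ∑ j ∈ ({i} : Finset (Fin d)), (1 - Real.cos (latticeMomentum L q j)) := by simp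
    _ ≤ ∑ j, (1 - Real.cos (latticeMomentum L q j)) :=
        sum_le_sum_of_subset_of_nonneg (by simp) fun j _ _ => hterm j
    _ = dispersion (latticeMomentum L q) := rfl

/-- The pointwise step (4)+Kubo ⇒ (5) ⇒ integrand of (8): if `0 ≤ g`, `g² E ≤ ¼ (d e₁ - e₃ C)`,
`|e₃| ≤ e₁`, `E > 0`, `d > 0`, then `g · (C/d) ≤ ½ √e₁ · [(d + C)/E]^{1/2} {C/d}₊`.
[Kennedy–Lieb–Shastry 1988, eqs. (5), (7), (8)] [folklore] -/
theorem kls_pointwise {g E C dd e₁ e₃ : ℝ} (hg : 0 ≤ g) (hE : 0 < E) (hdd : 0 < dd)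
    (hA : g ^ 2 * E ≤ 1 / 4 * (dd * e₁ - e₃ * C)) (hB : |e₃| ≤ e₁) :
    g * (C / dd) ≤ 1 / 2 * Real.sqrt e₁ * (Real.sqrt ((dd + C) / E) * max (C / dd) 0) := by
  have he₁ : 0 ≤ e₁ := (abs_nonneg _).trans hB
  rcases le_or_gt C 0 with hC | hC
  · calc g * (C / dd) ≤ 0 :=
          mul_nonpos_of_nonneg_of_nonpos hg (div_nonpos_of_nonpos_of_nonneg hC hdd.le)
      _ ≤ _ := by positivity
  · have hCd : 0 ≤ C / dd := by positivity
    rw [max_eq_left hCd, ← mul_assoc]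
    refine mul_le_mul_of_nonneg_right ?_ hCd
    rw [mul_assoc, ← Real.sqrt_mul he₁]
    -- `g ≤ ½ √(e₁ (d + C) / E)` iff `(2 g)² ≤ e₁ (d + C) / E`
    have h3 : -e₃ * C ≤ e₁ * C := mul_le_mul_of_nonneg_right ((neg_le_abs e₃).trans hB) hC.le
    have h4 : (2 * g) ^ 2 ≤ e₁ * ((dd + C) / E) := by
      rw [mul_div_assoc', le_div_iff₀ hE, show (2 * g) ^ 2 * E = 4 * (g ^ 2 * E) by ring]
      linarith
    have h5 : 2 * g ≤ Real.sqrt (e₁ * ((dd + C) / E)) :=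
      Real.le_sqrt_of_sq_le h4
    linarith

/-- **KLS eq. (7) in finite volume.** From (A), (B), (C): on the even torus of side `L = 2k ≥ 4`,
`e₁ ≤ |Λ|⁻¹ ĝ¹₀ + ½ e₁^{1/2} R_L`. [Kennedy–Lieb–Shastry 1988, eq. (7)]
[cite: KLS1988PRL, eq. (7)] -/
theorem kls_ineq7 (hA : kls_xy_infraredBound_ground) (hB : kubo_xy_bondCorr_abs_le)
    (hC : xy_structureFactor_sumRule) (hd : 2 ≤ d) {n : ℕ} (hn : 1 ≤ n) {k : ℕ} (hk : 2 ≤ k) :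
    xyBondCorr (d := d) 0 (2 * k) n ≤
      xyStructureFactor 0 (2 * k) n (0 : TorusSite d (2 * k)) / ((2 * k : ℕ) : ℝ) ^ d +
        1 / 2 * Real.sqrt (xyBondCorr (d := d) 0 (2 * k) n) * klsRiemannSum d (2 * k) := by
  haveI : NeZero (2 * k) := ⟨by omega⟩
  have hd0 : (0 : ℝ) < d := by exact_mod_cast (show 0 < d by omega)
  have hL : (0 : ℝ) < ((2 * k : ℕ) : ℝ) ^ d := by positivity
  set e₁ := xyBondCorr (d := d) 0 (2 * k) n with he₁
  set e₃ := xyBondCorr (d := d) 2 (2 * k) n with he₃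
  have hBk : |e₃| ≤ e₁ := hB d (by omega) n k (by omega)
  have hsum : ∑ q : TorusSite d (2 * k), xyStructureFactor 0 (2 * k) n q *
      (torusCosSum (2 * k) q / d) ≤
      xyStructureFactor 0 (2 * k) n (0 : TorusSite d (2 * k)) + 1 / 2 * Real.sqrt e₁ *
        ∑ q ∈ (univ : Finset (TorusSite d (2 * k))).erase 0,
          klsIntegrand d (latticeMomentum (2 * k) q) := by
    rw [← add_sum_erase _ _ (mem_univ (0 : TorusSite d (2 * k))), torusCosSum_zero,
      div_self hd0.ne', mul_one, mul_sum]
    refine add_le_add le_rfl ?_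
    refine sum_le_sum fun q hq => ?_
    have hq0 : q ≠ 0 := (mem_erase.1 hq).1
    obtain ⟨hg, hAq⟩ := hA d hd n hn k hk q hq0
    rw [sum_const_sub_mul_cos_latticeMomentum] at hAq
    rw [klsIntegrand_latticeMomentum]
    exact kls_pointwise hg (dispersion_latticeMomentum_pos hq0) hd0 hAq hBk
  have hCk := hC d (by omega) 0 (2 * k) n (by omega)
  rw [← he₁] at hCk
  rw [klsRiemannSum_of_neZero]
  calc e₁ = (∑ q : TorusSite d (2 * k), xyStructureFactor 0 (2 * k) n q *
          (torusCosSum (2 * k) q / d)) / ((2 * k : ℕ) : ℝ) ^ d := hCk.symm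
    _ ≤ (xyStructureFactor 0 (2 * k) n (0 : TorusSite d (2 * k)) + 1 / 2 * Real.sqrt e₁ *
          ∑ q ∈ (univ : Finset (TorusSite d (2 * k))).erase 0,
            klsIntegrand d (latticeMomentum (2 * k) q)) / ((2 * k : ℕ) : ℝ) ^ d :=
        div_le_div_of_nonneg_right hsum hL.le
    _ = _ := by rw [add_div, mul_div_assoc]

/-- Sums over the fundamental domain `halfOpenBox d L` of a pulled-back torus family are sums over
the torus (`torusProj_bijOn_halfOpenBox`). [folklore] -/
theorem XYOrderProofs.sum_halfOpenBox_torusPullback (G : (L : ℕ) → TorusSite d L → TorusSite d L → ℝ)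
    (L : ℕ) [NeZero L] :
    ∑ x ∈ halfOpenBox d L, ∑ y ∈ halfOpenBox d L, torusPullback G L x y =
      ∑ x : TorusSite d L, ∑ y : TorusSite d L, G L x y := by
  have hb := torusProj_bijOn_halfOpenBox (d := d) L
  have h1 : ∀ f : TorusSite d L → ℝ,
      ∑ x ∈ halfOpenBox d L, f (Torus.proj L x) = ∑ t, f t := by
    intro f
    refine sum_nbij (Torus.proj L) (fun x _ => mem_univ _) hb.injOn ?_ (fun _ _ => rfl)
    simpa using hb.surjOn
  simp only [torusPullback_apply]
  rw [h1 (fun t => ∑ y ∈ halfOpenBox d L, G L t (Torus.proj L y))]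
  exact sum_congr rfl fun t _ => h1 (fun s => G L t s)

/-- The LRO sequence of `XYOrder.lean` on the torus of side `L = 2k ≥ 2` equals `2 |Λ|⁻¹ ĝ¹₀`
(by (S), `Σ_α ⟨S^α_x S^α_y⟩ = 2 ⟨S¹_x S¹_y⟩`, and `ĝ¹₀ = |Λ|⁻¹ Σ_{x,y} G¹(x,y)`).
[Kennedy–Lieb–Shastry 1988, "LRO is equivalent to `m ≠ 0`"] [folklore] -/
theorem lroSeq_eq (hS : xy_groundCorr_two_eq_one) (n k : ℕ) (hk : 1 ≤ k) :
    (∑ x ∈ halfOpenBox d (2 * k), ∑ y ∈ halfOpenBox d (2 * k),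
        torusPullback (fun L x y => groundStateXYCorrTorus (d := d) L n x y) (2 * k) x y) /
        ((halfOpenBox d (2 * k)).card : ℝ) ^ 2 =
      2 * (xyStructureFactor 0 (2 * k) n (0 : TorusSite d (2 * k)) / ((2 * k : ℕ) : ℝ) ^ d) := by
  haveI : NeZero (2 * k) := ⟨by omega⟩
  have hL : ((2 * k : ℕ) : ℝ) ^ d ≠ 0 := by positivity
  have hS' : ∀ x y : TorusSite d (2 * k),
      xyGroundCorr 1 (2 * k) n x y = xyGroundCorr 0 (2 * k) n x y := fun x y => hS d (2 * k) n x y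
  rw [XYOrderProofs.sum_halfOpenBox_torusPullback, card_halfOpenBox, xyStructureFactor_zero_momentum]
  simp only [groundStateXYCorrTorus_eq_add, hS', ← two_mul, ← mul_sum]
  push_cast
  field_simp

/-- Boundedness of the LRO sequence, from (T): `|Λ|⁻² Σ_{x,y} (G¹ + G²) ≤ 2 S²`. [folklore] -/
theorem lroSeq_le (hT : xyGroundCorr_abs_le) (n k : ℕ) :
    (∑ x ∈ halfOpenBox d (2 * k), ∑ y ∈ halfOpenBox d (2 * k),
        torusPullback (fun L x y => groundStateXYCorrTorus (d := d) L n x y) (2 * k) x y) /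
        ((halfOpenBox d (2 * k)).card : ℝ) ^ 2 ≤ 2 * ((n : ℝ) / 2) ^ 2 := by
  have hc : 0 ≤ 2 * ((n : ℝ) / 2) ^ 2 := by positivity
  refine div_le_of_le_mul₀ (by positivity) hc ?_
  have hb : ∀ x y : Site d, torusPullback (fun L x y => groundStateXYCorrTorus (d := d) L n x y)
      (2 * k) x y ≤ 2 * ((n : ℝ) / 2) ^ 2 := by
    intro x y
    rw [torusPullback_apply, groundStateXYCorrTorus_eq_add]
    have h0 := le_of_abs_le (hT 0 d (2 * k) n (Torus.proj (2 * k) x) (Torus.proj (2 * k) y))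
    have h1 := le_of_abs_le (hT 1 d (2 * k) n (Torus.proj (2 * k) x) (Torus.proj (2 * k) y))
    linarith
  calc ∑ x ∈ halfOpenBox d (2 * k), ∑ y ∈ halfOpenBox d (2 * k),
        torusPullback (fun L x y => groundStateXYCorrTorus (d := d) L n x y) (2 * k) x y
      ≤ ∑ x ∈ halfOpenBox d (2 * k), ∑ y ∈ halfOpenBox d (2 * k), 2 * ((n : ℝ) / 2) ^ 2 :=
        sum_le_sum fun x _ => sum_le_sum fun y _ => hb x y
    _ = 2 * ((n : ℝ) / 2) ^ 2 * ((halfOpenBox d (2 * k)).card : ℝ) ^ 2 := by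
        simp only [sum_const, nsmul_eq_mul]
        ring

/-- The elementary monotonicity step: if `s ≤ e`, `0 ≤ s`, `0 ≤ R ≤ 4 √s`, then
`s - ½ √s R ≤ e - ½ √e R` (`t ↦ t² - ½ R t` is increasing on `t ≥ R/4`). [Kennedy–Lieb–Shastry
1988, "for any spin `S ≥ ½` … we conclude from (7) that `m ≠ 0`"] [folklore] -/
theorem kls_monotone_step {s e R : ℝ} (hs : 0 ≤ s) (hse : s ≤ e) (hR : R ≤ 4 * Real.sqrt s) :
    s - 1 / 2 * Real.sqrt s * R ≤ e - 1 / 2 * Real.sqrt e * R := by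
  have he : 0 ≤ e := hs.trans hse
  have h1 : Real.sqrt s ≤ Real.sqrt e := Real.sqrt_le_sqrt hse
  have h2 : (Real.sqrt s) ^ 2 = s := Real.sq_sqrt hs
  have h3 : (Real.sqrt e) ^ 2 = e := Real.sq_sqrt he
  -- (√e - √s)(√e + √s - R/2) ≥ 0
  nlinarith [mul_nonneg (sub_nonneg.2 h1) (show 0 ≤ Real.sqrt e + Real.sqrt s - R / 2 by
    nlinarith [Real.sqrt_nonneg s])]

/-- **Kennedy–Lieb–Shastry from (A)–(D), (S), (T) and an eventual bound on the Riemann sums.**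
If, for every `d ≥ 2`, the punctured Riemann sums `R_L` of the KLS integrand are eventually
`≤ ρ_d` for some `ρ_d < 1/√2` (`= 2√s` at the smallest spin `S = ½`, `s = S²/2`), then the ground
states of the quantum XY model have long-range order for all `d ≥ 2` and all spins: for
`L = 2k → ∞`, `|Λ|⁻² Σ_{x,y} ⟨S¹_x S¹_y + S²_x S²_y⟩ = 2|Λ|⁻¹ ĝ¹₀ ≥ 2 (S²/2 - ½ (S/√2) R_L)`
eventually. (This isolates what the proof consumes of (R), (M), (E): any route to
`limsup_L R_L(d) < 1/√2` will do.) [Kennedy–Lieb–Shastry 1988, Theorem, eqs. (5)–(8)]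
[cite: KLS1988PRL, Theorem] -/
theorem kennedy_lieb_shastry_xy_ground_of_riemannSum_le (hA : kls_xy_infraredBound_ground)
    (hB : kubo_xy_bondCorr_abs_le) (hC : xy_structureFactor_sumRule) (hD : kls_xy_bondCorr_lower)
    (hS : xy_groundCorr_two_eq_one) (hT : xyGroundCorr_abs_le)
    (hρ : ∀ d : ℕ, 2 ≤ d → ∃ ρ : ℝ, ρ < Real.sqrt 2 / 2 ∧
      ∀ᶠ L : ℕ in atTop, klsRiemannSum d L ≤ ρ) :
    kennedy_lieb_shastry_xy_ground := by
  intro d hd n hn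
  rw [hasEvenTorusLRO_iff]
  obtain ⟨ρ, hρlt, hρev⟩ := hρ d hd
  -- the constants
  set s : ℝ := ((n : ℝ) / 2) ^ 2 / 2 with hs_def
  have hn1 : (1 : ℝ) ≤ n := by exact_mod_cast hn
  have hs0 : 0 ≤ s := by positivity
  have h2pos : (0 : ℝ) < Real.sqrt 2 := by positivity
  have h22 : Real.sqrt 2 * Real.sqrt 2 = 2 := Real.mul_self_sqrt (by norm_num)
  have hsq : Real.sqrt s = n * Real.sqrt 2 / 4 := by
    have h2 : s = (n * Real.sqrt 2 / 4) ^ 2 := by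
      rw [hs_def, div_pow, div_pow, mul_pow, Real.sq_sqrt (by norm_num : (0 : ℝ) ≤ 2)]
      ring
    rw [h2, Real.sqrt_sq (by positivity)]
  -- `ρ₊ = max ρ 0 < √2 / 2 ≤ 2 √s`
  set ρ' : ℝ := max ρ 0 with hρ'_def
  have hρ'0 : 0 ≤ ρ' := le_max_right _ _
  have hρ'lt : ρ' < Real.sqrt 2 / 2 := max_lt hρlt (by positivity)
  have hss : Real.sqrt 2 / 4 ≤ Real.sqrt s := by
    rw [hsq]
    nlinarith
  set c : ℝ := 2 * (s - 1 / 2 * Real.sqrt s * ρ') with hc_def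
  have hc : 0 < c := by
    have h1 : Real.sqrt s * Real.sqrt s = s := Real.mul_self_sqrt hs0
    have h3 : 0 < Real.sqrt s - ρ' / 2 := by linarith
    have h4 : s - 1 / 2 * Real.sqrt s * ρ' = Real.sqrt s * (Real.sqrt s - ρ' / 2) := by
      rw [mul_sub, h1]; ring
    rw [hc_def, h4]
    exact mul_pos two_pos (mul_pos (lt_of_lt_of_le (by positivity) hss) h3)
  -- eventually `R_{2k} ≤ ρ'`
  have h2k : Tendsto (fun k : ℕ => 2 * k) atTop atTop :=
    tendsto_atTop_atTop.2 fun b => ⟨b, fun k hk => by omega⟩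
  have hRk : ∀ᶠ k : ℕ in atTop, klsRiemannSum d (2 * k) ≤ ρ' :=
    (h2k.eventually hρev).mono fun k hk => hk.trans (le_max_left _ _)
  -- eventually the LRO sequence is `≥ c`
  have hev : ∀ᶠ k : ℕ in atTop, c ≤
      (∑ x ∈ halfOpenBox d (2 * k), ∑ y ∈ halfOpenBox d (2 * k),
          torusPullback (fun L x y => groundStateXYCorrTorus (d := d) L n x y) (2 * k) x y) /
        ((halfOpenBox d (2 * k)).card : ℝ) ^ 2 := by
    filter_upwards [hRk, eventually_ge_atTop 2] with k hk hk2
    rw [lroSeq_eq hS n k (by omega)]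
    have h7 := kls_ineq7 hA hB hC hd hn hk2
    have hDk : s ≤ xyBondCorr (d := d) 0 (2 * k) n := hD d (by omega) (2 * k) n (by omega)
    have hR0 : 0 ≤ klsRiemannSum d (2 * k) := klsRiemannSum_nonneg _ _
    have h4s : klsRiemannSum d (2 * k) ≤ 4 * Real.sqrt s := by
      have : Real.sqrt 2 / 2 ≤ 4 * Real.sqrt s := by nlinarith
      linarith
    have hmono := kls_monotone_step hs0 hDk h4s
    have : s - 1 / 2 * Real.sqrt s * ρ' ≤ s - 1 / 2 * Real.sqrt s * klsRiemannSum d (2 * k) := by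
      nlinarith [Real.sqrt_nonneg s]
    rw [hc_def]
    linarith
  exact hc.trans_le
    (le_liminf_of_le (isCoboundedUnder_ge_of_le atTop fun k => lroSeq_le hT n k) hev)

/-- **Kennedy–Lieb–Shastry from its printed intermediate results.** The facts (A) infrared bound,
(B) Kubo, (C) sum rule, (D) `e₁ ≥ ½S²`, (S) `1 ↔ 2` symmetry, (T) a priori bound, (R) sums to
integrals, (M) `I(ν) ≤ I(2)`, (E) `I(2) ≤ 0.7` imply ground-state long-range order of the quantum
XY model for all `d ≥ 2` and all spins: `lim R_L = I(d) ≤ I(2) ≤ 0.7`, so eventually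
`R_L ≤ 0.701 < 1/√2`, and `kennedy_lieb_shastry_xy_ground_of_riemannSum_le` applies.
[Kennedy–Lieb–Shastry 1988, Theorem, eqs. (5)–(8)] [cite: KLS1988PRL, Theorem] -/
theorem kennedy_lieb_shastry_xy_ground_of_facts (hA : kls_xy_infraredBound_ground)
    (hB : kubo_xy_bondCorr_abs_le) (hC : xy_structureFactor_sumRule) (hD : kls_xy_bondCorr_lower)
    (hS : xy_groundCorr_two_eq_one) (hT : xyGroundCorr_abs_le) (hR : klsRiemannSum_tendsto)
    (hM : klsIntegral_le_two) (hE : klsIntegral_two_le) : kennedy_lieb_shastry_xy_ground := by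
  refine kennedy_lieb_shastry_xy_ground_of_riemannSum_le hA hB hC hD hS hT fun d hd => ?_
  refine ⟨701 / 1000, ?_, ?_⟩
  · have hsqrt2 : (1.402 : ℝ) < Real.sqrt 2 := by
      rw [Real.lt_sqrt (by norm_num)]
      norm_num
    linarith
  · have hE' : klsIntegral 2 ≤ 7 / 10 := hE
    have hM' : klsIntegral d ≤ klsIntegral 2 := hM d hd
    have hlt : ∀ᶠ L : ℕ in atTop, klsRiemannSum d L < 701 / 1000 :=
      (hR d hd).eventually_lt_const (by linarith)
    exact hlt.mono fun L hL => hL.le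

end Assembly

end Literature.MathematicalPhysics.QuantumLattice
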